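import Summits.NavierStokesRegularity.NavierStokesRegularity.Theorems.EulerZoomLiouvillePowerGaugeEulerLiouvilleNeedleFastSetMeasureStructural
import Summits.NavierStokesRegularity.NavierStokesRegularity.Theorems.EulerZoomLiouvillePowerGaugeEulerLiouvilleNeedleAxisymThinFastExits

/-!
# Thin fast exits WITHOUT SYMMETRY — the asymptotic choice of the band number
# (plate t39c-D of ROUND-38 «the waiting-time exponent»; crux E `PowerGaugeEulerLiouville`,
# stmt-NavierStokesRegularity-19832)

LANDING PLATE prepared by nsreg-p2 g33 (TEXT custody, DIRECTOR-NS #199 (1)) for a keyed PROVER hand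
(`--supports stmt-NavierStokesRegularity-19832 --as helper`).  No Euler content, NO SYMMETRY.

`thinFastExits`: for a `C¹` field `U` on `ℝ³` whose energy and Dirichlet budgets on balls grow at most polynomially
(`≤ c_A L^{1−2ρ}`, `≤ c_E L^{1−ρ}`, `ρ ≥ 0`, `L ≥ 1`), the `γ`-fast points at dyadic scale `R` live, over a set `G` of
squares of good radii of measure `≥ R²`, in a measurable `N ⊆ B_{2R}` with `volume N · ∫⁻_N ofReal ‖U‖² ≤ R^{−m}` for
every `m`, `R ≥ R₀(m)` — LITERALLY the statement of `NeedleAxisymBand.thinFastExits` (t38j-C, landed p639045) with the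
hypothesis `IsAxisymmetric U` DELETED, i.e. the hypothesis `hthin` (κ = 1) of `NeedleRace.curl_eq_zero_of_thinFastExits`
for a general profile.  Proof: `NeedleFastSetMeasure.thinFastExits_structural` (plate t39c-C) with the standard frame,
`B_A = c_A(2R)^{1−2ρ} ≤ 2c_A R`, `B_E ≤ 2c_E R`, thresholds `𝒜 ≤ 48a`, `ℰ ≤ 48e` (`a = 2c_A+1`, `e = 2c_E+1`), band number
`J = ⌊μR⌋` with `μ = min 1 (γ²/(614400(bandConst+1)(a+e)))`, which is admissible for `R ≥ 1`, and the size
`≤ (4608·a·c_A/γ²)·e^{1/4}·e^{−μR/4} < R^{−m}` eventually (`NeedleAxisymBand.exists_exp_lt_rpow_neg`).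
[arithmetic over plates t39b, t39c-A/B/C]
-/

set_option linter.dupNamespace false

open MeasureTheory Set Metric Real
open scoped RealInnerProductSpace ENNReal

namespace Summit.NavierStokesRegularity.NavierStokesRegularity.Theorems.PowerGaugeEulerLiouville.NeedleFastSetMeasure

open NeedleThinness NeedleBandLaw NeedleAxisymBand

/-! ## 1. Arithmetic of the parameters -/

/-- The standard frame of `ℝ³` is orthonormal. [folklore] -/
theorem orthonormal_stdFrame :
    Orthonormal ℝ ![(EuclideanSpace.basisFun (Fin 3) ℝ) 0, (EuclideanSpace.basisFun (Fin 3) ℝ) 1,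
      (EuclideanSpace.basisFun (Fin 3) ℝ) 2] := by
  have h : (![(EuclideanSpace.basisFun (Fin 3) ℝ) 0, (EuclideanSpace.basisFun (Fin 3) ℝ) 1,
      (EuclideanSpace.basisFun (Fin 3) ℝ) 2] : Fin 3 → EuclideanSpace ℝ (Fin 3)) = ⇑(EuclideanSpace.basisFun (Fin 3) ℝ) := by
    funext i; fin_cases i <;> simp
  rw [h]
  exact (EuclideanSpace.basisFun (Fin 3) ℝ).orthonormal

/-- Polynomial budget at `L = 2R`: `c(2R)^s ≤ 2cR` for `s ≤ 1`, `R ≥ 1`. [arithmetic] -/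
theorem budget_le_linear {c R s : ℝ} (hc : 0 ≤ c) (hR : 1 ≤ R) (hs : s ≤ 1) : c * (2 * R) ^ s ≤ 2 * c * R := by
  have h2R : (1 : ℝ) ≤ 2 * R := by linarith
  have h : (2 * R) ^ s ≤ (2 * R) ^ (1 : ℝ) := Real.rpow_le_rpow_of_exponent_le h2R hs
  rw [Real.rpow_one] at h
  nlinarith

/-- Threshold bound: `48(B+1)/R ≤ 48(2c+1)` when `B ≤ 2cR`, `R ≥ 1`. [arithmetic] -/
theorem threshold_le {c R B : ℝ} (hR : 1 ≤ R) (hB : B ≤ 2 * c * R) : 48 * (B + 1) / R ≤ 48 * (2 * c + 1) := by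
  have hR0 : 0 < R := by linarith
  rw [div_le_iff₀ hR0]
  nlinarith

/-- Admissibility (A) of `J ≤ μR`: `K·J²·(4𝒜/(γ²R²)) ≤ (R/20)²/8`. [arithmetic] -/
theorem admissibleA {K J μ R γ a e 𝒜 : ℝ} (hK : 0 ≤ K) (hJ0 : 0 ≤ J) (hJ : J ≤ μ * R) (hμ0 : 0 ≤ μ) (hμ1 : μ ≤ 1)
    (hμ : (K + 1) * (a + e) * μ ≤ γ ^ 2 / 614400) (hR : 1 ≤ R) (hγ : 0 < γ) (ha : 0 ≤ a) (he : 0 ≤ e)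
    (h𝒜0 : 0 ≤ 𝒜) (h𝒜 : 𝒜 ≤ 48 * a) :
    K * J ^ 2 * (4 * 𝒜 / (γ ^ 2 * R ^ 2)) ≤ (R / 20) ^ 2 / 8 := by
  have hR0 : 0 < R := by linarith
  have s1 : K * J ^ 2 * (4 * 𝒜 / (γ ^ 2 * R ^ 2)) ≤ (K + 1) * (μ * R) ^ 2 * (4 * (48 * a) / (γ ^ 2 * R ^ 2)) := by
    gcongr
    linarith
  have s2 : (K + 1) * (μ * R) ^ 2 * (4 * (48 * a) / (γ ^ 2 * R ^ 2)) = 192 * ((K + 1) * a * μ ^ 2) / γ ^ 2 := by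
    field_simp
    ring
  have s3 : (K + 1) * a * μ ^ 2 ≤ γ ^ 2 / 614400 := by
    have t1 : (K + 1) * a * μ ^ 2 = ((K + 1) * a * μ) * μ := by ring
    have t2 : (K + 1) * a * μ ≤ (K + 1) * (a + e) * μ :=
      mul_le_mul_of_nonneg_right (mul_le_mul_of_nonneg_left (by linarith) (by linarith)) hμ0
    have t3 : ((K + 1) * (a + e) * μ) * μ ≤ ((K + 1) * (a + e) * μ) * 1 :=
      mul_le_mul_of_nonneg_left hμ1 (by positivity)
    nlinarith
  have s4 : 192 * ((K + 1) * a * μ ^ 2) / γ ^ 2 ≤ 192 * (γ ^ 2 / 614400) / γ ^ 2 := by gcongr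
  have s5 : 192 * (γ ^ 2 / 614400) / γ ^ 2 = 1 / 3200 := by field_simp; ring
  have s6 : (1 : ℝ) / 3200 ≤ (R / 20) ^ 2 / 8 := by nlinarith
  linarith

/-- Admissibility (E) of `J ≤ μR`: `8K·J·(200/19)(𝒜 + (2R)²ℰ) ≤ (γR²/2)²`. [arithmetic] -/
theorem admissibleE {K J μ R γ a e 𝒜 ℰ : ℝ} (hK : 0 ≤ K) (hJ0 : 0 ≤ J) (hJ : J ≤ μ * R) (hμ0 : 0 ≤ μ)
    (hμ : (K + 1) * (a + e) * μ ≤ γ ^ 2 / 614400) (hR : 1 ≤ R) (ha : 0 ≤ a)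
    (h𝒜0 : 0 ≤ 𝒜) (h𝒜 : 𝒜 ≤ 48 * a) (hℰ0 : 0 ≤ ℰ) (hℰ : ℰ ≤ 48 * e) :
    8 * K * J * (200 / 19 * (𝒜 + (2 * R) ^ 2 * ℰ)) ≤ (γ * R ^ 2 / 2) ^ 2 := by
  have hR0 : 0 < R := by linarith
  have hR2 : 1 ≤ R ^ 2 := by nlinarith
  have s0 : 𝒜 + (2 * R) ^ 2 * ℰ ≤ 192 * (a + e) * R ^ 2 := by
    have : 48 * a ≤ 48 * a * R ^ 2 := by nlinarith
    nlinarith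
  have s1 : 8 * K * J * (200 / 19 * (𝒜 + (2 * R) ^ 2 * ℰ)) ≤ 8 * (K + 1) * (μ * R) * (11 * (192 * (a + e) * R ^ 2)) := by
    gcongr
    · linarith
    · norm_num
  have s2 : 8 * (K + 1) * (μ * R) * (11 * (192 * (a + e) * R ^ 2)) = 16896 * ((K + 1) * (a + e) * μ) * R ^ 3 := by ring
  have s3 : 16896 * ((K + 1) * (a + e) * μ) * R ^ 3 ≤ 16896 * (γ ^ 2 / 614400) * R ^ 3 := by gcongr
  have s4 : 16896 * (γ ^ 2 / 614400) * R ^ 3 ≤ (γ * R ^ 2 / 2) ^ 2 := by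
    have h34 : R ^ 3 ≤ R ^ 4 := pow_le_pow_right₀ hR (by norm_num)
    have h1 : γ ^ 2 * R ^ 3 ≤ γ ^ 2 * R ^ 4 := mul_le_mul_of_nonneg_left h34 (sq_nonneg γ)
    have h2 : 0 ≤ γ ^ 2 * R ^ 3 := mul_nonneg (sq_nonneg γ) (pow_nonneg hR0.le 3)
    nlinarith
  linarith

/-- The floor band number decays like `e^{−μR/4}`: `e^{−⌊μR⌋/4} ≤ e^{1/4}·e^{−(μ/4)R}`. [arithmetic] -/
theorem exp_floor_le (μ R : ℝ) : Real.exp (-(⌊μ * R⌋₊ : ℝ) / 4) ≤ Real.exp (1 / 4) * Real.exp (-(μ / 4) * R) := by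
  rw [← Real.exp_add, Real.exp_le_exp]
  have h := Nat.lt_floor_add_one (μ * R)
  linarith

/-- The size coefficient: `48𝒜/(γ²R)·B_A ≤ 4608·a·c_A/γ²` when `𝒜 ≤ 48a`, `B_A ≤ 2c_A R`. [arithmetic] -/
theorem sizeCoeff_le {𝒜 γ R BA a cA : ℝ} (hγ : 0 < γ) (hR : 0 < R) (h𝒜 : 𝒜 ≤ 48 * a) (hBA0 : 0 ≤ BA)
    (hBA : BA ≤ 2 * cA * R) (ha : 0 ≤ a) :
    48 * 𝒜 / (γ ^ 2 * R) * BA ≤ 4608 * a * cA / γ ^ 2 := by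
  rw [div_mul_eq_mul_div, div_le_div_iff₀ (by positivity) (by positivity)]
  have h1 : 48 * 𝒜 * BA ≤ 48 * (48 * a) * (2 * cA * R) := by gcongr
  nlinarith [sq_nonneg γ, mul_nonneg (sq_nonneg γ) hR.le]

/-! ## 2. Thin fast exits for a general `C¹` profile -/

/-- **Thin fast exits, NO SYMMETRY** — the hypothesis `hthin` (κ = 1) of `…NeedleRace.curl_eq_zero_of_thinFastExits`
for a `C¹` field with polynomially bounded energy / Dirichlet budgets on balls; `NeedleAxisymBand.thinFastExits`
(t38j-C) with `IsAxisymmetric U` deleted. [plates t39b + t39c] -/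
theorem thinFastExits {U : (EuclideanSpace ℝ (Fin 3)) → (EuclideanSpace ℝ (Fin 3))} (hU : ContDiff ℝ 1 U) {γ ρ cA cE : ℝ}
    (hγ : 0 < γ) (hρ : 0 ≤ ρ) (hcA : 0 ≤ cA) (hcE : 0 ≤ cE)
    (hbA : ∀ L : ℝ, 1 ≤ L →
      ∫⁻ z in Metric.closedBall (0 : (EuclideanSpace ℝ (Fin 3))) L, (‖U z‖ₑ : ℝ≥0∞) ^ 2 ≤ ENNReal.ofReal (cA * L ^ (1 - 2 * ρ)))
    (hbE : ∀ L : ℝ, 1 ≤ L →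
      ∫⁻ z in Metric.closedBall (0 : (EuclideanSpace ℝ (Fin 3))) L, (‖fderiv ℝ U z‖ₑ : ℝ≥0∞) ^ 2 ≤ ENNReal.ofReal (cE * L ^ (1 - ρ)))
    (m : ℝ) :
    ∃ R₀ : ℝ, ∀ R : ℝ, R₀ ≤ R → ∃ (G : Set ℝ) (N : Set (EuclideanSpace ℝ (Fin 3))), MeasurableSet G ∧ G ⊆ Icc (R ^ 2) ((2 * R) ^ 2) ∧
      1 * R ^ 2 ≤ (volume G).toReal ∧ MeasurableSet N ∧ N ⊆ Metric.closedBall 0 (2 * R) ∧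
      (∀ z, ‖z‖ ^ 2 ∈ G → inner ℝ (U z) z + γ * ‖z‖ ^ 2 < 0 → z ∈ N) ∧
      volume N * ∫⁻ z in N, ENNReal.ofReal (‖U z‖ ^ 2) ≤ ENNReal.ofReal (R ^ (-m)) := by
  -- constants
  obtain ⟨a, ha⟩ : ∃ a : ℝ, a = 2 * cA + 1 := ⟨_, rfl⟩
  obtain ⟨e, he⟩ : ∃ e : ℝ, e = 2 * cE + 1 := ⟨_, rfl⟩
  have ha0 : 0 < a := by rw [ha]; positivity
  have he0 : 0 < e := by rw [he]; positivity
  have hK := bandConst_nonneg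
  obtain ⟨μ, hμd⟩ : ∃ μ : ℝ, μ = min 1 (γ ^ 2 / (614400 * (bandConst + 1) * (a + e))) := ⟨_, rfl⟩
  have hμ0 : 0 < μ := by rw [hμd]; positivity
  have hμ1 : μ ≤ 1 := by rw [hμd]; exact min_le_left _ _
  have hμ : (bandConst + 1) * (a + e) * μ ≤ γ ^ 2 / 614400 := by
    have h1 : μ ≤ γ ^ 2 / (614400 * (bandConst + 1) * (a + e)) := by rw [hμd]; exact min_le_right _ _
    have h2 : 0 < 614400 * (bandConst + 1) * (a + e) := by positivity
    rw [le_div_iff₀ h2] at h1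
    rw [le_div_iff₀ (by norm_num : (0 : ℝ) < 614400)]
    nlinarith
  have hK0 : 0 < 4608 * a * (cA + 1) / γ ^ 2 * Real.exp (1 / 4) := by positivity
  obtain ⟨R₂, hR₂⟩ := exists_exp_lt_rpow_neg hK0 (by positivity : 0 < μ / 4) m
  refine ⟨max (max 1 (1 / μ)) R₂, fun R hR => ?_⟩
  have hR1 : 1 ≤ R := le_trans (le_max_left _ _) ((le_max_left _ _).trans hR)
  have hRμ : 1 / μ ≤ R := le_trans (le_max_right _ _) ((le_max_left _ _).trans hR)
  have hRR₂ : R₂ ≤ R := (le_max_right _ _).trans hR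
  have hR0 : 0 < R := by linarith
  have h2R : 1 ≤ 2 * R := by linarith
  -- budgets at L = 2R
  obtain ⟨BA, hBAd⟩ : ∃ b : ℝ, b = cA * (2 * R) ^ (1 - 2 * ρ) := ⟨_, rfl⟩
  obtain ⟨BE, hBEd⟩ : ∃ b : ℝ, b = cE * (2 * R) ^ (1 - ρ) := ⟨_, rfl⟩
  have hBA0 : 0 ≤ BA := by rw [hBAd]; positivity
  have hBE0 : 0 ≤ BE := by rw [hBEd]; positivity
  have hBA2 : BA ≤ 2 * cA * R := by rw [hBAd]; exact budget_le_linear hcA hR1 (by linarith)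
  have hBE2 : BE ≤ 2 * cE * R := by rw [hBEd]; exact budget_le_linear hcE hR1 (by linarith)
  have hIA : ∫⁻ y in closedBall (0 : (EuclideanSpace ℝ (Fin 3))) (2 * R), ‖U y‖ₑ ^ 2 ≤ ENNReal.ofReal BA := by
    rw [hBAd]; exact hbA (2 * R) h2R
  have hIE : ∫⁻ y in closedBall (0 : (EuclideanSpace ℝ (Fin 3))) (2 * R), ‖fderiv ℝ U y‖ₑ ^ 2 ≤ ENNReal.ofReal BE := by
    rw [hBEd]; exact hbE (2 * R) h2R
  -- thresholds
  obtain ⟨𝒜, h𝒜d⟩ : ∃ x : ℝ, x = 48 * (BA + 1) / R := ⟨_, rfl⟩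
  obtain ⟨ℰ, hℰd⟩ : ∃ x : ℝ, x = 48 * (BE + 1) / R := ⟨_, rfl⟩
  have h𝒜0 : 0 ≤ 𝒜 := by rw [h𝒜d]; positivity
  have hℰ0 : 0 ≤ ℰ := by rw [hℰd]; positivity
  have h𝒜a : 𝒜 ≤ 48 * a := by rw [h𝒜d, ha]; exact threshold_le hR1 hBA2
  have hℰe : ℰ ≤ 48 * e := by rw [hℰd, he]; exact threshold_le hR1 hBE2
  -- the band number
  have hμR : 1 ≤ μ * R := by
    rw [div_le_iff₀ hμ0] at hRμ
    linarith
  have hJ : 0 < ⌊μ * R⌋₊ := Nat.floor_pos.2 hμR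
  have hJle : (⌊μ * R⌋₊ : ℝ) ≤ μ * R := Nat.floor_le (by positivity)
  have hJA : bandConst * (⌊μ * R⌋₊ : ℝ) ^ 2 * (4 * 𝒜 / (γ ^ 2 * R ^ 2)) ≤ (R / 20) ^ 2 / 8 :=
    admissibleA hK (Nat.cast_nonneg _) hJle hμ0.le hμ1 hμ hR1 hγ ha0.le he0.le h𝒜0 h𝒜a
  have hJE : 8 * bandConst * (⌊μ * R⌋₊ : ℝ) * (200 / 19 * (𝒜 + (2 * R) ^ 2 * ℰ)) ≤ (γ * R ^ 2 / 2) ^ 2 :=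
    admissibleE hK (Nat.cast_nonneg _) hJle hμ0.le hμ hR1 ha0.le h𝒜0 h𝒜a hℰ0 hℰe
  -- the structural theorem
  obtain ⟨G, N, h1, h2, h3, h4, h5, h6, h7⟩ :=
    thinFastExits_structural orthonormal_stdFrame hU hγ hR0 hBA0 hBE0 hIA hIE h𝒜d hℰd hJ hJA hJE
  refine ⟨G, N, h1, h2, h3, h4, h5, h6, h7.trans (ENNReal.ofReal_le_ofReal ?_)⟩
  -- the size
  have hcoef : 48 * 𝒜 / (γ ^ 2 * R) * BA ≤ 4608 * a * cA / γ ^ 2 := sizeCoeff_le hγ hR0 h𝒜a hBA0 hBA2 ha0.le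
  have hcoef' : 4608 * a * cA / γ ^ 2 ≤ 4608 * a * (cA + 1) / γ ^ 2 := by gcongr; linarith
  have hexp := exp_floor_le μ R
  calc 48 * 𝒜 / (γ ^ 2 * R) * Real.exp (-(⌊μ * R⌋₊ : ℝ) / 4) * BA
      = (48 * 𝒜 / (γ ^ 2 * R) * BA) * Real.exp (-(⌊μ * R⌋₊ : ℝ) / 4) := by ring
    _ ≤ (4608 * a * (cA + 1) / γ ^ 2) * (Real.exp (1 / 4) * Real.exp (-(μ / 4) * R)) :=
        mul_le_mul (hcoef.trans hcoef') hexp (Real.exp_pos _).le (by positivity)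
    _ = 4608 * a * (cA + 1) / γ ^ 2 * Real.exp (1 / 4) * Real.exp (-(μ / 4) * R) := by ring
    _ ≤ R ^ (-m) := (hR₂ R hRR₂ hR0).le

end Summit.NavierStokesRegularity.NavierStokesRegularity.Theorems.PowerGaugeEulerLiouville.NeedleFastSetMeasure
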